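import Literature.Probability.RandomPlanarGeometry.SLETraceEightOfUST
import Literature.Probability.RandomPlanarGeometry.LSW2004USTRado
import HarnessLib

/-!
# [LSW04] Thm. 4.7 (SLE₈ is generated by a curve) from Prop. 4.5 and Thm. 4.4 AS PRINTED

G. F. Lawler, O. Schramm, W. Werner, *Conformal invariance of planar loop-erased random walks and
uniform spanning trees*, Ann. Probab. **32** (2004) 939–995 (**[LSW04]**), proof of Thm. 4.7,
p. 981. Proof-only file (no definitions, no named facts) recording the current frontier of
`Literature.Probability.RandomPlanarGeometry.hasSLETrace_eight` after `LSW2004USTRado.lean`: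
the tree's `USTPeano.hasSLETrace_eight_of_prop45_of_drivingProcess_tendsto`
(`SLETraceEightOfUST.lean`) needs Prop. 4.5 (explicit hypothesis) and the named fact
`USTPeano.drivingProcess_tendsto` ([LSW04] p. 981, "Theorem 4.4 implies that the law of `W`
converges weakly to the law of `B(8t)`"); the latter now follows from Thm. 4.4 in its printed
coupling shape alone (`USTPeano.drivingProcess_tendsto_of_thm44'`: the convergence
`R⁻¹ φ_R⁻¹ → φ⁻¹` of p. 977 being proved via Radó's theorem). Hence:

* `USTPeano.hasSLETrace_eight_of_prop45_of_thm44` — **(Prop. 4.5) → (Thm. 4.4 as printed) →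
  hasSLETrace_eight** (the printed wording of Thm. 4.7 — `gₜ⁻¹` extends continuously to `ℍ̄`,
  `γ(t) = gₜ⁻¹(B(8t))` is continuous and generates the chain — is the same proposition,
  `LawlerSchrammWerner2004_thm47_iff_hasSLETrace_eight`, `SLETraceEight.lean`).

So exactly the two probabilistic theorems of [LSW04] §4 about the UST Peano curve remain between
the tree and "SLE₈ is generated by a continuous transient curve": Prop. 4.5 (uniform continuity,
p. 977) and Thm. 4.4 (driving process convergence, p. 976) — the UST/LERW theory of §4.1–4.2 and
§5 (Wilson's algorithm, the Dirichlet–Neumann approximation Prop. 4.1, the key estimate Prop. 4.2,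
Skorokhod embedding, Koebe distortion), not in the tree.

## References

* [LSW04] Thm. 4.4 (p. 976), Prop. 4.5 (p. 977), Thm. 4.7 and its proof (p. 981)
  [LawlerSchrammWerner2004].
-/

noncomputable section

open MeasureTheory Metric Complex
open UpperHalfPlane (upperHalfPlaneSet)
open scoped NNReal

namespace Literature.Probability.RandomPlanarGeometry

open scoped PathBorel

namespace USTPeano

/-- **[LSW04] Thm. 4.7 from Prop. 4.5 and Thm. 4.4 as printed.** `h45` = Prop. 4.5 (p. 977) in
the shape of `hasSLETrace_eight_of_prop45_of_drivingProcess_tendsto`; `h44` = Thm. 4.4 (p. 976: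
"For every positive `ε₁, ε₂, ε₃` and `t̄`, there is some positive `r₁` such that … if
`rad₀(D) > r₁` and `ℌ_D(0, α) ∈ [ε₁, 1 - ε₁]` … there is a coupling of standard Brownian motion
`B` and `W` such that `P[sup_{[0,t̄]} |W(t) - B(8t)| > ε₂] < ε₃`") in the shape of
`drivingProcess_tendsto_of_thm44` (see its docstring for the rendering of `rad₀` and `ℌ_D`).
[cite: LawlerSchrammWerner2004, Thm. 4.7] -/
theorem hasSLETrace_eight_of_prop45_of_thm44
    (h45 : ∀ (D : SmoothDomain) (ε t : ℝ), 0 < ε → 0 < t →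
      ∃ R₀ δ : ℝ, 0 < δ ∧ ∀ (R : ℝ) (Δ : Domain), R₀ < R → IsApproximation D R Δ →
        ∀ (φ : ConformalEquiv upperHalfPlaneSet Δ.carrier), Δ.IsLSWMap φ →
          ∀ (Γ : PeanoPath Δ → C(ℝ≥0, ℂ)) (W : PeanoPath Δ → C(ℝ≥0, ℝ)),
            (∀ γ, IsCapacityImage Δ φ γ (Γ γ) (W γ)) →
              ustLaw Δ {γ | ∃ t₁ t₂ : ℝ≥0, (t₁ : ℝ) ≤ t ∧ (t₂ : ℝ) ≤ t ∧
                dist t₁ t₂ ≤ δ ∧ ε < dist (Γ γ t₁) (Γ γ t₂)} < ENNReal.ofReal ε)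
    (h44 : ∀ (ε₁ ε₂ ε₃ T : ℝ), 0 < ε₁ → 0 < ε₂ → 0 < ε₃ → 0 < T → ∃ r₁ : ℝ, ∀ (Δ : Domain),
      (0 : ℂ) ∈ Δ.carrier → ball (0 : ℂ) r₁ ⊆ Δ.carrier →
      ∀ (φ : ConformalEquiv upperHalfPlaneSet Δ.carrier), Δ.IsLSWMap φ →
        ε₁ * Real.pi ≤ arg (φ.symm 0) → arg (φ.symm 0) ≤ (1 - ε₁) * Real.pi →
        ∀ (Γ : PeanoPath Δ → C(ℝ≥0, ℂ)) (W : PeanoPath Δ → C(ℝ≥0, ℝ)),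
          (∀ γ, IsCapacityImage Δ φ γ (Γ γ) (W γ)) →
          ∃ ρ : Measure (C(ℝ≥0, ℝ) × C(ℝ≥0, ℝ)), ρ.fst = (ustLaw Δ).map W ∧
            ρ.snd = Process.preWienerMeasure.map brownianTimeEight ∧
            ρ {p | ∃ t : ℝ≥0, (t : ℝ) ≤ T ∧ ε₂ < dist (p.1 t) (p.2 t)} < ENNReal.ofReal ε₃) :
    hasSLETrace_eight :=
  hasSLETrace_eight_of_prop45_of_drivingProcess_tendsto h45 (drivingProcess_tendsto_of_thm44' h44)

end USTPeano

end Literature.Probability.RandomPlanarGeometry
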